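import Summits.AtomisticToContinuum.Crystallization.Theorems.FreeSplittingCertificatesRadiusLadderJoint47over40Off11
import Summits.AtomisticToContinuum.Crystallization.Theorems.FreeSplittingCertificatesRadiusLadderJointSiteNat
import Summits.AtomisticToContinuum.Crystallization.Theorems.FreeSplittingCertificatesRadiusLadderJointFarTail
import Summits.AtomisticToContinuum.Crystallization.Theorems.FreeSplittingCertificatesRadiusLadderHalfRule65

/-!
# Joint multi-shell certificate at hard core `47/40` — the rung `δ_½ ≤ 47/40` (`FiniteRangeSplitting`, stmt-AtomisticToContinuum-12559)

Support theorem for crux r2 of route `FreeSplittingCertificates` (block-2b unit `b2b-freesplit-A`, gen 40): the next rung of the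
radius ladder's `δ`-axis below the degree-`7` layer cake (`…RadiusLadderHalfRule65`, `δ_½ ≤ 6/5`).  VALUE = a kernel-checked
matrix-valued Delsarte (joint multi-shell, Lasserre level-1) certificate — NOT summit progress; the cell's `R = 2` verdict is unchanged.

Assembly: the tables of `…Joint47over40Data` and the OFF facts of `…Joint47over40Off*` discharge the hypotheses of
`site_sum_le_of_jointCert_nat` (`…RadiusLadderJointSiteNat`) with `φ = −V`, giving `Σ_{j ≠ i, r_ij < 12δ} (−V(r_ij)) ≤ β₀ + Σ_q λ_q m_q`;
the far field `r ≥ 12δ` is `sum_inv_pow_six_far12_le`; `totalQ_le` closes `Σ_{j≠i} V(r_ij) ≥ −1.435 = 2·(−0.7175) ≥ 2 e_∞`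
(`eInf_le_ref`), whence `HalfSumFeasible 47/40`, `RungAt 47/40 R` for every `R`, and `halfSumThreshold ≤ 47/40`.
-/

noncomputable section

open Finset

namespace Summit.AtomisticToContinuum.Crystallization.Theorems.StrictSplittingRuleBirth

open Literature.MathematicalPhysics.StatisticalMechanics

namespace Joint47over40

/-! ## Real data -/

/-- `e k = eQ k`. -/
private theorem e_eq (k : ℕ) : e k = ((eQ k : ℚ) : ℝ) := by
  unfold e eQ
  split_ifs <;> push_cast <;> ring

/-- `e 0 = δ`. -/
private theorem e_zero : e 0 = ((47 : ℝ) / 40) := by norm_num [e]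

/-- `e NC = 12 δ`. -/
private theorem e_last : e NC = 12 * ((47 : ℝ) / 40) := by norm_num [e, NC]

/-- Edges increase. -/
private theorem e_lt_succ : ∀ k, k < NC → e k < e (k + 1) := by
  intro k hk
  have h := eQ_lt_succ ⟨k, hk⟩
  rw [e_eq, e_eq]
  exact_mod_cast h

/-- `δ ≤ e k` for `k ≤ NC`. -/
private theorem DL_le_e {k : ℕ} (hk : k ≤ NC) : ((47 : ℝ) / 40) ≤ e k := by
  rw [← e_zero]; exact edges_mono e_lt_succ 0 k (Nat.zero_le _) hk

/-- Real weights. -/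
def wR (i : Fin NC) : ℝ := ((wQ i : ℚ) : ℝ)

/-- Real `b` (zero on LP-only cells). -/
def bR (i : Fin NC) : ℝ := if h : (i : ℕ) < NH then ((bQ ⟨i, h⟩ : ℚ) : ℝ) else 0

/-- Real `G_k` (zero off the kernel cells). -/
def GR (k : Fin 8) (i j : Fin NC) : ℝ :=
  if h : (i : ℕ) < NH ∧ (j : ℕ) < NH then GK k ⟨i, h.1⟩ ⟨j, h.2⟩ else 0

/-- Real factors `R_k/2^D` (zero columns off the kernel cells). -/
def RR (k : Fin 8) (m : Fin 13) (i : Fin NC) : ℝ :=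
  if h : (i : ℕ) < NH then (Rz k m ⟨i, h⟩ : ℝ) / 2 ^ 30 else 0

/-- Real bordered factor `R₀/2^D` on `Fin (NC+1)` (zero columns beyond `NH`). -/
def RR0 (m : Fin 12) (i : Fin (NC + 1)) : ℝ :=
  if h : (i : ℕ) < NH + 1 then (Rz0 m ⟨i, h⟩ : ℝ) / 2 ^ 30 else 0

/-- `β₀`. -/
def beta0R : ℝ := ((beta0Q : ℚ) : ℝ)

/-- Count sets `S_q = {cells ≤ hi_q}`. -/
def S (q : Fin 27) : Finset (Fin NC) := Finset.univ.filter fun i => (i : ℕ) ≤ hiT q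

/-- Real multipliers. -/
def lamR (q : Fin 27) : ℝ := ((lamQ q : ℚ) : ℝ)

/-! ## The factor identities (`hG`, `hZ`) -/

/-- Cast of an integer Gram sum to `ℝ` (factor identity helper). -/
private theorem cast_gram (u v : Fin 13 → ℤ) :
    ((((∑ m, u m * v m : ℤ) : ℚ) / 4 ^ 30 : ℚ) : ℝ) = ∑ m, ((u m : ℝ) / 2 ^ 30) * ((v m : ℝ) / 2 ^ 30) := by
  push_cast
  rw [Finset.sum_div]
  refine Finset.sum_congr rfl fun m _ => ?_
  ring

/-- Cast of an integer Gram sum to `ℝ`, bordered block. -/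
private theorem cast_gram0 (u v : Fin 12 → ℤ) :
    ((((∑ m, u m * v m : ℤ) : ℚ) / 4 ^ 30 : ℚ) : ℝ) = ∑ m, ((u m : ℝ) / 2 ^ 30) * ((v m : ℝ) / 2 ^ 30) := by
  push_cast
  rw [Finset.sum_div]
  refine Finset.sum_congr rfl fun m _ => ?_
  ring

/-- `G_k = R_kᵀR_k` for `k ≥ 1`. -/
private theorem hG : ∀ k : Fin 8, k ≠ 0 → ∀ i j : Fin NC, GR k i j = ∑ m, RR k m i * RR k m j := by
  intro k hk i j
  by_cases hi : (i : ℕ) < NH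
  · by_cases hj : (j : ℕ) < NH
    · simp only [GR, hi, hj, and_self, dite_true, GK, GQ, hk, if_false, RR]
      exact cast_gram _ _
    · simp [GR, RR, hj]
  · simp [GR, RR, hi]

/-- Index bookkeeping: `i+1 < NH+1` for kernel cells. -/
private theorem succ_lt_NH_succ {i : Fin NC} (hi : (i : ℕ) < NH) : ((i.succ : Fin (NC + 1)) : ℕ) < NH + 1 := by
  simp [Fin.val_succ]; omega

/-- Index bookkeeping for the bordered block. -/
private theorem mk_succ_eq {i : Fin NC} (hi : (i : ℕ) < NH) :
    (⟨((i.succ : Fin (NC + 1)) : ℕ), succ_lt_NH_succ hi⟩ : Fin (NH + 1)) = (⟨i, hi⟩ : Fin NH).succ := by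
  ext; simp [Fin.val_succ]

/-- The bordered block is a Gram matrix: `β₀`, `b`, `G₀` from `R₀`. -/
private theorem hZ : ∀ v : Fin NC → ℝ, 0 ≤ beta0R + 2 * ∑ i, bR i * v i + ∑ i, ∑ i', v i * v i' * GR 0 i i' := by
  have h0 : ((0 : Fin (NC + 1)) : ℕ) < NH + 1 := Nat.succ_pos _
  have hz0 : (⟨((0 : Fin (NC + 1)) : ℕ), h0⟩ : Fin (NH + 1)) = 0 := rfl
  refine bordered_nonneg_of_factor beta0R bR (GR 0) RR0 ?_ ?_ ?_
  · simp only [beta0R, beta0Q, RR0, h0, dite_true, hz0]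
    exact cast_gram0 _ _
  · intro i
    by_cases hi : (i : ℕ) < NH
    · simp only [bR, hi, dite_true, bQ, RR0, succ_lt_NH_succ hi, h0, mk_succ_eq hi, hz0]
      exact cast_gram0 _ _
    · simp [bR, hi, RR0]
  · intro i i'
    by_cases hi : (i : ℕ) < NH
    · by_cases hj : (i' : ℕ) < NH
      · simp only [GR, hi, hj, and_self, dite_true, GK, GQ, if_true, RR0, succ_lt_NH_succ hi, succ_lt_NH_succ hj,
          mk_succ_eq hi, mk_succ_eq hj]
        exact cast_gram0 _ _
      · simp [GR, hj, RR0]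
    · simp [GR, hi, RR0]

/-! ## OFF -/

/-- `cbar4` is the cast of its `ℚ` mirror. -/
private theorem cbar4_cast (δ a b a' b' : ℚ) :
    cbar4 (δ : ℝ) (a : ℝ) (b : ℝ) (a' : ℝ) (b' : ℝ) = ((cbar4Q δ a b a' b' : ℚ) : ℝ) := by
  simp only [cbar4, cbar4Q, cosCorner, cosCornerQ]
  push_cast
  rfl

/-- `cbar4` is symmetric in the two cells. -/
private theorem cbar4_symm (δ a b a' b' : ℝ) : cbar4 δ a b a' b' = cbar4 δ a' b' a b := by
  simp only [cbar4, cosCorner_comm δ a a', cosCorner_comm δ a b', cosCorner_comm δ b a', cosCorner_comm δ b b']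
  rw [max_max_max_comm]

/-- From `t ≤ 1` and `t ≤ c̄` to `t ≤ cT`. -/
private theorem le_cT (a b : Fin NH) {t : ℝ} (h2 : t ≤ 1)
    (h3 : t ≤ cbar4 ((47 : ℝ) / 40) (e a) (e ((a : ℕ) + 1)) (e b) (e ((b : ℕ) + 1))) : t ≤ ((cT a b : ℚ) : ℝ) := by
  rcases cT_ok a b with h | h
  · exact h2.trans (by exact_mod_cast h)
  · rw [e_eq, e_eq, e_eq, e_eq, show (((47 : ℝ) / 40) : ℝ) = ((((47 : ℚ) / 40) : ℚ) : ℝ) by push_cast; norm_num, cbar4_cast] at h3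
    exact h3.trans (by exact_mod_cast h)

/-- The OFF hypothesis of `site_sum_le_of_jointCert_nat`, all cell pairs. -/
private theorem hOFF : ∀ i i' : Fin NC, ∀ t : ℝ, -1 ≤ t → t ≤ 1 →
    t ≤ cbar4 ((47 : ℝ) / 40) (e i) (e (i + 1)) (e i') (e (i' + 1)) → ∑ k : Fin 8, GR k i i' * legPn (k : ℕ) t ≤ 0 := by
  intro i i' t h1 h2 h3
  by_cases hi : (i : ℕ) < NH
  · by_cases hj : (i' : ℕ) < NH
    · have hg : ∀ k, GR k i i' = GK k ⟨i, hi⟩ ⟨i', hj⟩ := fun k => by simp [GR, hi, hj]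
      simp only [hg]
      rcases le_total (i : ℕ) i' with hle | hle
      · exact off_le ⟨i, hi⟩ ⟨i', hj⟩ hle t h1 (le_cT ⟨i, hi⟩ ⟨i', hj⟩ h2 h3)
      · have hs : ∀ k, GK k ⟨i, hi⟩ ⟨i', hj⟩ = GK k ⟨i', hj⟩ ⟨i, hi⟩ := fun k => by
          simp only [GK, GQ_symm k ⟨i, hi⟩ ⟨i', hj⟩]
        simp only [hs]
        rw [cbar4_symm] at h3
        exact off_le ⟨i', hj⟩ ⟨i, hi⟩ hle t h1 (le_cT ⟨i', hj⟩ ⟨i, hi⟩ h2 h3)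
    · simp [GR, hj]
  · simp [GR, hi]

/-! ## Counts, DIAG, weights -/

/-- Multipliers are nonnegative (real cast). -/
private theorem hlam : ∀ q, 0 ≤ lamR q := fun q => by
  have := lamQ_nonneg q; unfold lamR; exact_mod_cast this

/-- Members of the count set `S q` lie below the top cell `hiT q + 1`. -/
private theorem hS : ∀ (q : Fin 27) (i : Fin NC), i ∈ S q → (i : ℕ) < hiT q + 1 := by
  intro q i hi
  simp only [S, Finset.mem_filter, Finset.mem_univ, true_and] at hi
  omega

/-- The integer capacities dominate the volume bound `(2e/δ+1)^3 - 1`. -/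
private theorem hm : ∀ q : Fin 27, (2 * e (hiT q + 1) / ((47 : ℝ) / 40) + 1) ^ 3 - 1 < ((mT q : ℕ) : ℝ) + 1 := by
  intro q
  have h := mT_ok q
  have hc : (((47 : ℝ) / 40) : ℝ) = ((((47 : ℚ) / 40) : ℚ) : ℝ) := by push_cast; norm_num
  rw [e_eq, hc]
  exact_mod_cast h

/-- `LamQ i` is the sum of the multipliers of the counts containing cell `i`. -/
private theorem cast_LamQ (i : ℕ) : ((LamQ i : ℚ) : ℝ) = ∑ q : Fin 27, if i ≤ hiT q then lamR q else 0 := by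
  unfold LamQ lamR
  push_cast
  refine Finset.sum_congr rfl fun q _ => ?_
  split_ifs <;> simp

/-- The DIAG conditions of the certificate (kernel cells and LP-only cells). -/
private theorem hDIAG : ∀ i : Fin NC, 2 * bR i + ∑ k, GR k i i + wR i ≤ ∑ q, if i ∈ S q then lamR q else 0 := by
  intro i
  have hrhs : (∑ q, if i ∈ S q then lamR q else 0) = ((LamQ i : ℚ) : ℝ) := by
    rw [cast_LamQ]
    refine Finset.sum_congr rfl fun q _ => ?_
    simp [S]
  rw [hrhs]
  by_cases hi : (i : ℕ) < NH
  · have h := diagQ_ker ⟨i, hi⟩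
    have h' : ((2 * bQ ⟨i, hi⟩ + ∑ k : Fin 8, GQ k ⟨i, hi⟩ ⟨i, hi⟩ + wQ i : ℚ) : ℝ) ≤ ((LamQ i : ℚ) : ℝ) := by
      exact_mod_cast h
    have hl : 2 * bR i + ∑ k, GR k i i + wR i =
        ((2 * bQ ⟨i, hi⟩ + ∑ k : Fin 8, GQ k ⟨i, hi⟩ ⟨i, hi⟩ + wQ i : ℚ) : ℝ) := by
      simp only [bR, GR, GK, wR, hi, and_self, dite_true]
      push_cast
      rfl
    rw [hl]; exact h'
  · have h := diagQ_lp i (not_lt.mp hi)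
    have h' : ((wQ i : ℚ) : ℝ) ≤ ((LamQ i : ℚ) : ℝ) := by exact_mod_cast h
    have hl : 2 * bR i + ∑ k, GR k i i + wR i = ((wQ i : ℚ) : ℝ) := by simp [bR, GR, wR, hi]
    rw [hl]; exact h'

/-- `−V` is antitone on `[1, ∞)` (elementary: `g = (2a − a²)/12` in `a = r⁻⁶ ∈ (0, 1]`). -/
private theorem neg_lennardJones_anti {s t : ℝ} (hs : 1 ≤ s) (hst : s ≤ t) : -lennardJones t ≤ -lennardJones s := by
  have hs0 : 0 < s := by linarith
  have ht0 : 0 < t := by linarith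
  have ha1 : (s⁻¹) ^ 6 ≤ 1 := by
    have : s⁻¹ ≤ 1 := inv_le_one_of_one_le₀ hs
    calc (s⁻¹) ^ 6 ≤ 1 ^ 6 := by gcongr
      _ = 1 := one_pow 6
  have hba : (t⁻¹) ^ 6 ≤ (s⁻¹) ^ 6 := by
    have : t⁻¹ ≤ s⁻¹ := inv_anti₀ hs0 hst
    have ht' : 0 ≤ t⁻¹ := inv_nonneg.mpr ht0.le
    gcongr
  have hb0 : 0 ≤ (t⁻¹) ^ 6 := by positivity
  have e1 : lennardJones s = (1 / 12) * ((s⁻¹) ^ 6) ^ 2 - (1 / 6) * (s⁻¹) ^ 6 := by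
    simp only [lennardJones]; ring
  have e2 : lennardJones t = (1 / 12) * ((t⁻¹) ^ 6) ^ 2 - (1 / 6) * (t⁻¹) ^ 6 := by
    simp only [lennardJones]; ring
  rw [e1, e2]
  nlinarith [mul_nonneg (sub_nonneg.2 hba) (by linarith : (0 : ℝ) ≤ 2 - (s⁻¹) ^ 6 - (t⁻¹) ^ 6)]

/-- The cell weights majorise `−V` cellwise. -/
private theorem hw : ∀ i : Fin NC, ∀ r, e i ≤ r → r < e ((i : ℕ) + 1) → -lennardJones r ≤ wR i := by
  intro i r h1 _h2
  have hDLi : ((47 : ℝ) / 40) ≤ e i := DL_le_e (le_of_lt i.is_lt)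
  have h1e : 1 ≤ e i := le_trans (by norm_num) hDLi
  have hmono := neg_lennardJones_anti h1e h1
  have hval : -lennardJones (e i) = wR i := by
    simp only [wR, wQ, lennardJones, e_eq]
    push_cast
    ring
  linarith [hval]

/-! ## The site bound and the floor of the pair-sum -/

/-- **Near field**: `Σ_{j ≠ i, r_ij < 12δ} (−V(r_ij)) ≤ β₀ + Σ_q λ_q m_q`. -/
theorem near_le {N : ℕ} {x : Fin N → EuclideanSpace ℝ (Fin 3)} (hx : Sep ((47 : ℝ) / 40) x) (i : Fin N) :
    ∑ j ∈ (Finset.univ.erase i).filter (fun j => dist (x i) (x j) < e NC), -lennardJones (dist (x i) (x j)) ≤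
      beta0R + ∑ q, lamR q * ((mT q : ℕ) : ℝ) :=
  site_sum_le_of_jointCert_nat (n := NC) (L := 7) (by norm_num) e e_zero e_lt_succ (by decide)
    (fun k => (k : ℕ)) rfl beta0R bR wR GR RR hZ hG hOFF S lamR mT hlam (fun q => hiT q + 1) hiT_lt hS hm hDIAG
    (fun r => -lennardJones r) hw hx i

/-- The total over `ℝ`. -/
theorem total_le : beta0R + ∑ q, lamR q * ((mT q : ℕ) : ℝ) + 729 / 4608 / (6 * ((47 : ℝ) / 40) ^ 6) ≤ 1435 / 1000 := by
  have h := totalQ_le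
  have h' : ((beta0Q + ∑ q, lamQ q * (mT q : ℚ) + 729 / 4608 / (6 * ((47 : ℚ) / 40) ^ 6) : ℚ) : ℝ) ≤ ((1435 / 1000 : ℚ) : ℝ) := by
    exact_mod_cast h
  have hc : ((beta0Q + ∑ q, lamQ q * (mT q : ℚ) + 729 / 4608 / (6 * ((47 : ℚ) / 40) ^ 6) : ℚ) : ℝ) =
      beta0R + ∑ q, lamR q * ((mT q : ℕ) : ℝ) + 729 / 4608 / (6 * ((47 : ℝ) / 40) ^ 6) := by
    simp only [beta0R, lamR]
    push_cast
    norm_num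
  have hd : (((1435 / 1000 : ℚ)) : ℝ) = 1435 / 1000 := by push_cast; norm_num
  linarith [hc, hd, h']

/-- **Certified floor**: at every site of every `47/40`-separated finite configuration the pair-sum is `≥ −1.435`. -/
theorem sum_lennardJones_ge_of_sepJ {N : ℕ} {x : Fin N → EuclideanSpace ℝ (Fin 3)} (hx : Sep ((47 : ℝ) / 40) x) (i : Fin N) :
    -(1435 / 1000 : ℝ) ≤ ∑ j ∈ Finset.univ.erase i, lennardJones (dist (x i) (x j)) := by
  classical
  have hDL : (0 : ℝ) < ((47 : ℝ) / 40) := by norm_num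
  set T := Finset.univ.erase i with hT
  have hsplit := (Finset.sum_filter_add_sum_filter_not T (fun j => dist (x i) (x j) < e NC)
    (fun j => lennardJones (dist (x i) (x j)))).symm
  -- near part
  have hnear : -(beta0R + ∑ q, lamR q * ((mT q : ℕ) : ℝ)) ≤
      ∑ j ∈ T.filter (fun j => dist (x i) (x j) < e NC), lennardJones (dist (x i) (x j)) := by
    have h := near_le hx i
    rw [Finset.sum_neg_distrib] at h
    linarith
  -- far part
  have hfar : -(729 / 4608 / (6 * ((47 : ℝ) / 40) ^ 6)) ≤
      ∑ j ∈ T.filter (fun j => ¬ dist (x i) (x j) < e NC), lennardJones (dist (x i) (x j)) := by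
    have hsep : ∀ k l : Fin N, k ≠ l → ((47 : ℝ) / 40) ≤ dist (x k) (x l) := fun k l hkl => hx k l hkl
    have htail := sum_inv_pow_six_far12_le x hDL hsep i
    have hflt : T.filter (fun j => ¬ dist (x i) (x j) < e NC) = T.filter (fun j => 12 * ((47 : ℝ) / 40) ≤ dist (x i) (x j)) := by
      refine Finset.filter_congr fun j _ => ?_
      rw [e_last, not_lt]
    rw [hflt]
    have hpt : ∀ j ∈ T.filter (fun j => 12 * ((47 : ℝ) / 40) ≤ dist (x i) (x j)),
        -((1 / 6) * (dist (x i) (x j))⁻¹ ^ 6) ≤ lennardJones (dist (x i) (x j)) := by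
      intro j hj
      have hd : 0 < dist (x i) (x j) := lt_of_lt_of_le (by positivity) (Finset.mem_filter.1 hj).2
      exact neg_le_lennardJones_of_le hd le_rfl
    have hsum := Finset.sum_le_sum hpt
    rw [Finset.sum_neg_distrib, ← Finset.mul_sum] at hsum
    have hDL6 : (729 : ℝ) / 4608 / (6 * ((47 : ℝ) / 40) ^ 6) = (1 / 6) * (729 / 4608 * ((47 : ℝ) / 40)⁻¹ ^ 6) := by
      field_simp
    rw [hDL6]
    have := mul_le_mul_of_nonneg_left htail (by norm_num : (0 : ℝ) ≤ 1 / 6)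
    linarith
  rw [hsplit]
  linarith [total_le]

/-- **The half pair-sum never drops below `−0.7175` at hard core `47/40`.** -/
theorem halfSum_ge_of_sepJ {N : ℕ} {x : Fin N → EuclideanSpace ℝ (Fin 3)} (hx : Sep ((47 : ℝ) / 40) x) (i : Fin N) :
    -(7175 / 10000 : ℝ) ≤ (∑ j ∈ Finset.univ.erase i, lennardJones (dist (x i) (x j))) / 2 := by
  have := sum_lennardJones_ge_of_sepJ hx i
  linarith

/-! ## The rung and the bracket -/

/-- **The deepest-site inequality holds at hard core `47/40`.** -/
theorem halfSumFeasible_J : HalfSumFeasible ((47 : ℝ) / 40) := fun _ _ hx i =>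
  eInf_le_ref.trans (halfSum_ge_of_sepJ hx i)

/-- **`RungAt 47/40 R` for every `R`.** -/
theorem rungAt_J (R : ℝ) : RungAt ((47 : ℝ) / 40) R :=
  rungAt_of_halfSumFeasible halfSumFeasible_J R

/-- Every `δ ≥ 47/40` has every rung. -/
theorem rungAt_of_le {δ : ℝ} (hδ : ((47 : ℝ) / 40) ≤ δ) (R : ℝ) : RungAt δ R :=
  rungAt_of_halfSumFeasible (halfSumFeasible_mono hδ halfSumFeasible_J) R

/-- **`δ_½ ≤ 47/40`.** -/
theorem halfSumThreshold_le_J : halfSumThreshold ≤ ((47 : ℝ) / 40) :=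
  halfSumThreshold_le_of halfSumFeasible_J

/-- **The bracket**: `47/50 ≤ δ_½ ≤ 47/40`. -/
theorem halfSumThreshold_mem_Icc_J : halfSumThreshold ∈ Set.Icc ((47 : ℝ) / 50) ((47 : ℝ) / 40) :=
  ⟨halfSumThreshold_mem_Icc_47_50_6_5.1, halfSumThreshold_le_J⟩

end Joint47over40

end Summit.AtomisticToContinuum.Crystallization.Theorems.StrictSplittingRuleBirth

end
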